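import Summits.QuantumFields.YangMills.Theorems.BalabanUVNodesN07AliasSumMargin
import Summits.QuantumFields.YangMills.Theorems.BalabanUVNodesN07PointFeasibilityOneLevelFourier
import HarnessLib

/-!
# DAG node N07 [B11], road R0′ — the ONE-LEVEL MARGIN WITH THE SHARP CONSTANT ONE for block side `L = 3`:
# two exact alias identities (odd `L`) and the sharp one-coordinate domination «centre ≥ matched» at `L = 3`

Cell `pub-ymgap` (HUMAN RULINGS D-0062 ∕ D-0149 ∕ D-0154), width seat `pub-ymgap-dag-n07-w5` g2, 2026-08-28.  `--kind proof --supports <K1 key>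
--as helper` (count-neutral; CLAIM-3 cell bus 10:58Z).  Road item (L1) of `pub-ymgap-dag-n07-w5/LOCATED-PD-LOCALIZATION-ROAD.md` was landed by
dag-n07-w7 g4 with the explicit constant `π^{−|J|}` (`…N07AliasSumMargin.matchedSymbol_le_aliasSymbolK`); numerically the true constant is `1`
(`LOCATED-SHARP-CENTRE-DOMINANCE.md`).  THIS FILE proves the sharp constant for the smallest admissible block side `L = 3` ([I] (0.4): centres of
blocks force odd `L`), per coordinate; the tensorisation over coordinates is dag-n07-w7's `aliasCore_margin` («domination constants multiply») BY NAME
(§2 end); the displays «K₀(θ) ≤ K(θ)» and the x-space form via p626779 follow in the sequel `…SharpSmallLSymbols`.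

THE PRINT.  [B5] = T. Bałaban, CMP **95** (1984) 17–40 `[Balaban1984PropagatorsI]`, (1.29)–(1.33) p. 23 (`p = p′ + l`, `u_k`, «Σ_l |u_k(p′+l)|²∕Δ²»);
[B6] = CMP **96** (1984) 223–250 `[Balaban1984PropagatorsII]`, (2.22) p. 226 (block means); [I] = CMP **109** (1987) 249–301 `[Balaban1987RG1]`, (0.4)
p. 253 (the averaging of record samples block CENTRES; odd `L`).  Nothing of these is cited as a hypothesis; every statement is [folklore]
trigonometry.

WHAT THIS FILE DOES (`x_m := (ϑ+2πm)∕(2L)`, `s_m := sin x_m`, `w := sin(ϑ∕2)∕L`, `D_m := (−1)^m w∕s_m` = the Lagrange basis of trigonometric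
interpolation at an off-grid point, `ϑ ∈ (0,2π)`):
* §1 ★ `sum_neg_one_pow_mul_sin_half_div` (`Σ_{m<L} D_m = 1`, odd `L = 2c+1`: each `D_m` is the Dirichlet kernel `sin(Lξ∕2)∕(L sin(ξ∕2))` at
  `ξ_m = (ϑ+2πm)∕L`, i.e. g0′'s `centred_factor` geometric sum `L⁻¹Σ_{r<L} e^{i(c−r)ξ_m}`, and `Σ_m e^{i(c−r)ξ_m} = L·δ_{r,c}` by King's discrete
  orthogonality `sum_exp_two_pi_mul_I_mul_div`) · ★ `sum_neg_one_pow_mul_sineAlias` (`Σ_{m<L} (−1)^m s_m = 0`: imaginary part of the geometric sum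
  `e^{iϑ∕(2L)}Σ_m (−e^{iπ∕L})^m`, whose ratio has `(−e^{iπ∕L})^L = 1`);
* §2 `sin_three_mul_le`, `sin_half_le_three_mul_sineAlias_zero∕_two` (`w ≤ s_0, s_2` at `L = 3`), `sineAlias_three_le_mid` (`s_0, s_2 ≤ s_1`),
  ★★ `sineAlias_domination_sharp_three`: for `L = 3`, `G ∈ iterMono 1`, `x ≥ 0`,
  `w · Σ_{m<3} G(x+s_m²)∕s_m² ≤ transfer 3 s G x` — dag-n07-w7's `sineAlias_domination` WITHOUT the factor `1∕π`: the single negative term sits at the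
  largest `s`, so `Σ_m e_m G_m ≥ (Σ_m e_m)·G_1 = 0` with `e_m = (−1)^m∕s_m − w∕s_m²` and `Σ e_m = 0` by the two identities `Σ D_m = 1` (§1) and
  `Σ D_m² = 1` (King's `aliasing_identity`); ★★★ `aliasSum_margin_sharp_three` (dag-n07-w7's `aliasCore_margin` BY NAME tensorises it: their
  `aliasSum_margin` with `(πL)^{|J|}` replaced by `L^{|J|}` — «K₀ ≤ K» with constant ONE for `L = 3`, every finite `J`; displays in the sequel).

HONEST FRAMING (binding).  Count-neutral helper; elementary trigonometry on finite alias sums at ONE averaging level; the sharp constant for `L ≥ 7` is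
OPEN (for `L = 5` see the sequel); asserts NOTHING of [B11]∕[B6]∕[3]; `(P)_D` ∕ (L2)–(L4) OPEN; nothing consumed under road (a); `hker` ∕ stub 1 ∕
K0⁷ ∕ K1⁹ NOT closed; N07 NOT discharged; counts unmoved; no summit statement is proved by this seat — R4 closes the conditional finite-𝕋⁴ rung
`BalabanLadder.UV` only; nothing continuum ∕ ℝ⁴ ∕ OS ∕ mass gap ∕ Clay.  No `sorry`, no `def`, no `instance`, no `notation`.
-/

noncomputable section

open Finset

namespace Summit.QuantumFields.YangMills.Theorems.N07AliasSumMarginSharp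

open Summit.QuantumFields.YangMills.Theorems.N07AliasSumPositivity
open Summit.QuantumFields.YangMills.Theorems.N07AliasSumMargin
open Summit.QuantumFields.YangMills.BalabanUVNodes.N07PointFeasibilityOneLevel (centred_factor)
open Literature.MathematicalPhysics.QuantumFieldTheory.King1986 (sum_exp_two_pi_mul_I_mul_div aliasing_identity)

/-! ## §1  Two exact alias identities for odd `L` -/

section Identities

open Complex
open scoped ComplexConjugate

/-- The alias angles `(ϑ + 2πm)∕(2L)`, `m < L`, have non-vanishing sine for `ϑ ∈ (0,2π)`. [folklore] -/
theorem sin_aliasAngle_ne_zero {ϑ : ℝ} (h0 : 0 < ϑ) (h1 : ϑ < 2 * Real.pi) {L m : ℕ} (hm : m < L) :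
    Real.sin ((ϑ + 2 * Real.pi * m) / (2 * L)) ≠ 0 :=
  (Summit.QuantumFields.YangMills.Theorems.N07AliasSumPositivity.sineAlias_pos h0 h1 hm).ne'

/-- ★ **The alternating aliasing identity of CENTRE sampling** (the `Σ_j D_j = 1` of the Lagrange basis at an off-grid point; odd `L = 2c+1`,
`ϑ ∈ (0,2π)`): `Σ_{m<L} (−1)^m sin(ϑ∕2) ∕ (L·sin((ϑ+2πm)∕(2L))) = 1` — each term is the Dirichlet kernel `sin(Lξ_m∕2)∕(L sin(ξ_m∕2))`,
`ξ_m = (ϑ+2πm)∕L`, i.e. (g0′'s `centred_factor`) the geometric sum `L⁻¹ Σ_{r<L} e^{i(c−r)ξ_m}`, and `Σ_{m<L} e^{i(c−r)ξ_m} = L·δ_{r,c}`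
(discrete orthogonality, King's `sum_exp_two_pi_mul_I_mul_div`). [folklore] -/
theorem sum_neg_one_pow_mul_sin_half_div (c : ℕ) {L : ℕ} (hL : 2 * c + 1 = L) {ϑ : ℝ} (h0 : 0 < ϑ)
    (h1 : ϑ < 2 * Real.pi) :
    ∑ m ∈ range L, (-1 : ℝ) ^ m * Real.sin (ϑ / 2) / ((L : ℝ) * Real.sin ((ϑ + 2 * Real.pi * m) / (2 * L))) = 1 := by
  have hLpos : 0 < L := by omega
  have hL0 : (L : ℝ) ≠ 0 := by positivity
  have hLc : (L : ℂ) ≠ 0 := by exact_mod_cast hLpos.ne'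
  have hLne : L ≠ 0 := hLpos.ne'
  set ξ : ℕ → ℝ := fun m => (ϑ + 2 * Real.pi * m) / L with hξ
  -- each real term is g0′'s centred factor at `ξ m`
  have hterm : ∀ m ∈ range L,
      (((-1 : ℝ) ^ m * Real.sin (ϑ / 2) / ((L : ℝ) * Real.sin ((ϑ + 2 * Real.pi * m) / (2 * L))) : ℝ) : ℂ)
        = Complex.exp ((ξ m : ℂ) * I) ^ c *
            conj ((Complex.exp ((ξ m : ℂ) * I) ^ L - 1) / ((L : ℂ) * (Complex.exp ((ξ m : ℂ) * I) - 1))) := by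
    intro m hm
    have hmL : m < L := mem_range.mp hm
    have e2 : ξ m / 2 = (ϑ + 2 * Real.pi * m) / (2 * L) := by rw [hξ]; field_simp
    have hsinm : Real.sin (ξ m / 2) ≠ 0 := by rw [e2]; exact sin_aliasAngle_ne_zero h0 h1 hmL
    rw [centred_factor c hL (ξ m) hsinm]
    congr 1
    have e1 : (L : ℝ) * ξ m / 2 = ϑ / 2 + m * Real.pi := by rw [hξ]; field_simp
    rw [e1, Real.sin_add_nat_mul_pi, e2]
  -- pass to `ℂ`
  rw [← Complex.ofReal_inj, Complex.ofReal_sum, Complex.ofReal_one, Finset.sum_congr rfl hterm]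
  -- `exp(iξ_m)^L = exp(iϑ)` and the geometric sum
  have hpowL : ∀ m : ℕ, Complex.exp ((ξ m : ℂ) * I) ^ L = Complex.exp ((ϑ : ℂ) * I) := by
    intro m
    rw [← Complex.exp_nat_mul, hξ]
    push_cast
    have e : (L : ℂ) * ((ϑ + 2 * Real.pi * m) / L * I) = ϑ * I + (m : ℂ) * (2 * Real.pi * I) := by
      field_simp
    rw [e, Complex.exp_add, Complex.exp_nat_mul_two_pi_mul_I, mul_one]
  have hz1 : ∀ m ∈ range L, Complex.exp ((ξ m : ℂ) * I) ≠ 1 := by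
    intro m hm h
    have hmL : m < L := mem_range.mp hm
    have hn := Complex.norm_exp_I_mul_ofReal_sub_one (ξ m)
    rw [mul_comm, h, sub_self, norm_zero] at hn
    have e2 : ξ m / 2 = (ϑ + 2 * Real.pi * m) / (2 * L) := by rw [hξ]; field_simp
    have hs := sin_aliasAngle_ne_zero h0 h1 hmL
    rw [← e2] at hs
    have : ‖2 * Real.sin (ξ m / 2)‖ ≠ 0 := by
      rw [norm_ne_zero_iff]; exact mul_ne_zero two_ne_zero hs
    exact this hn.symm
  have hgeom : ∀ m ∈ range L,
      Complex.exp ((ξ m : ℂ) * I) ^ c *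
          conj ((Complex.exp ((ξ m : ℂ) * I) ^ L - 1) / ((L : ℂ) * (Complex.exp ((ξ m : ℂ) * I) - 1)))
        = (L : ℂ)⁻¹ * ∑ r ∈ range L, Complex.exp ((((c : ℂ) - r) * ξ m) * I) := by
    intro m hm
    have hne := hz1 m hm
    have hsub : Complex.exp ((ξ m : ℂ) * I) - 1 ≠ 0 := sub_ne_zero.mpr hne
    rw [show (Complex.exp ((ξ m : ℂ) * I) ^ L - 1) / ((L : ℂ) * (Complex.exp ((ξ m : ℂ) * I) - 1))
        = (L : ℂ)⁻¹ * ((Complex.exp ((ξ m : ℂ) * I) ^ L - 1) / (Complex.exp ((ξ m : ℂ) * I) - 1)) by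
          field_simp,
      ← geom_sum_eq hne L, map_mul, map_inv₀, Complex.conj_natCast, map_sum, Finset.mul_sum, Finset.mul_sum,
      Finset.mul_sum]
    refine Finset.sum_congr rfl fun r _ => ?_
    rw [map_pow, ← Complex.exp_conj, map_mul, Complex.conj_ofReal, Complex.conj_I, ← Complex.exp_nat_mul,
      ← Complex.exp_nat_mul, mul_left_comm, ← Complex.exp_add]
    congr 2
    ring
  rw [Finset.sum_congr rfl hgeom, ← Finset.mul_sum, Finset.sum_comm]
  -- discrete orthogonality in `m`
  have horth : ∀ r ∈ range L, ∑ m ∈ range L, Complex.exp ((((c : ℂ) - r) * ξ m) * I)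
      = if c = r then (L : ℂ) * Complex.exp ((((c : ℂ) - r) * (ϑ / L)) * I) else 0 := by
    intro r hr
    have hrL : r < L := mem_range.mp hr
    have hcL : c < L := by omega
    have e : ∀ m : ℕ, Complex.exp ((((c : ℂ) - r) * ξ m) * I)
        = Complex.exp ((((c : ℂ) - r) * (ϑ / L)) * I) * Complex.exp (2 * Real.pi * I * ((c : ℂ) - r) / L * m) := by
      intro m
      rw [← Complex.exp_add, hξ]
      push_cast
      congr 1
      field_simp
    simp_rw [e]
    rw [← Finset.mul_sum, sum_exp_two_pi_mul_I_mul_div hLne hcL hrL]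
    split_ifs <;> ring
  rw [Finset.sum_congr rfl horth, Finset.sum_ite_eq, if_pos (mem_range.mpr (by omega)), sub_self, zero_mul,
    zero_mul, Complex.exp_zero, mul_one, inv_mul_cancel₀ hLc]

/-- ★ **The alternating alias sine sum vanishes** (the `Σ_j D_j sin²x_j = 0` of exact quadrature at degree one; odd `L`, any `ϑ`):
`Σ_{m<L} (−1)^m sin((ϑ+2πm)∕(2L)) = 0` — the imaginary part of the geometric sum `e^{iϑ∕(2L)} Σ_m (−e^{iπ∕L})^m`, whose ratio satisfies
`(−e^{iπ∕L})^L = 1`. [folklore] -/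
theorem sum_neg_one_pow_mul_sineAlias {L : ℕ} (hL : Odd L) (h2 : 2 ≤ L) (ϑ : ℝ) :
    ∑ m ∈ range L, (-1 : ℝ) ^ m * Real.sin ((ϑ + 2 * Real.pi * m) / (2 * L)) = 0 := by
  have hL0 : (L : ℝ) ≠ 0 := by positivity
  have hLc : (L : ℂ) ≠ 0 := by exact_mod_cast (show (L : ℕ) ≠ 0 by omega)
  set w : ℂ := -Complex.exp (((Real.pi / L : ℝ) : ℂ) * I) with hw
  -- the complex sum `Σ_m (−1)^m e^{i a_m} = e^{iϑ∕(2L)} Σ_m w^m` vanishes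
  have hterm : ∀ m : ℕ, (((-1 : ℝ) ^ m : ℝ) : ℂ) * Complex.exp ((((ϑ + 2 * Real.pi * m) / (2 * L) : ℝ) : ℂ) * I)
      = Complex.exp (((ϑ / (2 * L) : ℝ) : ℂ) * I) * w ^ m := by
    intro m
    have e : ((((ϑ + 2 * Real.pi * m) / (2 * L) : ℝ) : ℂ) * I)
        = (((ϑ / (2 * L) : ℝ) : ℂ) * I) + (m : ℂ) * ((((Real.pi / L : ℝ) : ℂ) * I)) := by
      push_cast
      field_simp
    rw [e, Complex.exp_add, Complex.exp_nat_mul, hw, neg_pow (Complex.exp (((Real.pi / L : ℝ) : ℂ) * I)) m]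
    push_cast
    ring
  have hw1 : w ≠ 1 := by
    intro h
    have hre := congrArg Complex.re h
    rw [hw, Complex.neg_re, Complex.exp_ofReal_mul_I_re, Complex.one_re] at hre
    have hLr : (3 : ℝ) ≤ L ∨ (L : ℝ) = 2 := by
      rcases Nat.lt_or_ge L 3 with h' | h'
      · right; exact_mod_cast (show L = 2 by omega)
      · left; exact_mod_cast h'
    have hcos : 0 ≤ Real.cos (Real.pi / L) := by
      apply Real.cos_nonneg_of_neg_pi_div_two_le_of_le
      · have : 0 < Real.pi / L := by positivity
        linarith [Real.pi_pos]
      · have h2r : (2 : ℝ) ≤ L := by exact_mod_cast h2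
        exact div_le_div_of_nonneg_left Real.pi_pos.le (by norm_num) h2r
    linarith
  have hwL : w ^ L = 1 := by
    rw [hw, neg_pow, hL.neg_one_pow, ← Complex.exp_nat_mul]
    have e : (L : ℂ) * (((Real.pi / L : ℝ) : ℂ) * I) = Real.pi * I := by
      push_cast
      field_simp
    rw [e, Complex.exp_pi_mul_I]
    norm_num
  have key : ∑ m ∈ range L, (((-1 : ℝ) ^ m : ℝ) : ℂ) *
      Complex.exp ((((ϑ + 2 * Real.pi * m) / (2 * L) : ℝ) : ℂ) * I) = 0 := by
    simp_rw [hterm]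
    rw [← Finset.mul_sum, geom_sum_eq hw1, hwL, sub_self, zero_div, mul_zero]
  -- imaginary parts
  have him := congrArg Complex.im key
  rw [Complex.im_sum, Complex.zero_im] at him
  rw [← him]
  refine Finset.sum_congr rfl fun m _ => ?_
  rw [Complex.im_ofReal_mul, Complex.exp_ofReal_mul_I_im]


end Identities

/-! ## §2  The sharp one-coordinate domination for `L = 3` -/

section Three

open Real

/-- `sin 3u ≤ 3 sin u` for `sin u ≥ 0`. [folklore] -/
theorem sin_three_mul_le {u : ℝ} (hu : 0 ≤ sin u) : sin (3 * u) ≤ 3 * sin u := by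
  rw [Real.sin_three_mul]
  nlinarith [pow_nonneg hu 3]

/-- For `L = 3` the centre weight at the LEFT end is at most one: `sin(ϑ∕2) ≤ 3·sin(ϑ∕6)` (`ϑ ∈ (0,2π)`). [folklore] -/
theorem sin_half_le_three_mul_sineAlias_zero {ϑ : ℝ} (h0 : 0 < ϑ) (h1 : ϑ < 2 * π) :
    sin (ϑ / 2) ≤ 3 * sin (ϑ / (2 * 3)) := by
  rw [show ϑ / 2 = 3 * (ϑ / (2 * 3)) by ring]
  exact sin_three_mul_le (sin_nonneg_of_nonneg_of_le_pi (by linarith) (by linarith [pi_pos]))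

/-- For `L = 3` the centre weight at the RIGHT end is at most one: `sin(ϑ∕2) ≤ 3·sin((ϑ+4π)∕6)`. [folklore] -/
theorem sin_half_le_three_mul_sineAlias_two {ϑ : ℝ} (h0 : 0 < ϑ) (h1 : ϑ < 2 * π) :
    sin (ϑ / 2) ≤ 3 * sin ((ϑ + 2 * π * 2) / (2 * 3)) := by
  have e : (ϑ + 2 * π * 2) / (2 * 3) = π - (2 * π - ϑ) / 6 := by ring
  rw [e, sin_pi_sub, show ϑ / 2 = π - 3 * ((2 * π - ϑ) / 6) by ring, sin_pi_sub]
  exact sin_three_mul_le (sin_nonneg_of_nonneg_of_le_pi (by linarith) (by linarith [pi_pos]))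

/-- For `L = 3` the MIDDLE alias sine is the largest: `sin(ϑ∕6) ≤ sin((ϑ+2π)∕6)` and `sin((ϑ+4π)∕6) ≤ sin((ϑ+2π)∕6)`
(`ϑ ∈ (0,2π)`; both outer angles are within `π∕3` of `0` or `π`, the middle one within `π∕6` of `π∕2`). [folklore] -/
theorem sineAlias_three_le_mid {ϑ : ℝ} (h0 : 0 < ϑ) (h1 : ϑ < 2 * π) :
    sin (ϑ / (2 * 3)) ≤ sin ((ϑ + 2 * π) / (2 * 3)) ∧
      sin ((ϑ + 2 * π * 2) / (2 * 3)) ≤ sin ((ϑ + 2 * π) / (2 * 3)) := by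
  have hπ := pi_pos
  have e2 : (ϑ + 2 * π * 2) / (2 * 3) = π - (2 * π - ϑ) / 6 := by ring
  rw [e2, sin_pi_sub]
  -- the middle sine dominates `sin(π∕3)`, the outer ones are dominated by it
  have hmid : sin (π / 3) ≤ sin ((ϑ + 2 * π) / (2 * 3)) := by
    by_cases h : (ϑ + 2 * π) / (2 * 3) ≤ π / 2
    · exact sin_le_sin_of_le_of_le_pi_div_two (by linarith) h (by linarith)
    · push Not at h
      rw [← sin_pi_sub ((ϑ + 2 * π) / (2 * 3))]
      exact sin_le_sin_of_le_of_le_pi_div_two (by linarith) (by linarith) (by linarith)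
  constructor
  · exact (sin_le_sin_of_le_of_le_pi_div_two (by linarith) (by linarith) (by linarith)).trans hmid
  · exact (sin_le_sin_of_le_of_le_pi_div_two (by linarith) (by linarith) (by linarith)).trans hmid

/-- ★★ **SHARP one-coordinate domination for block side `L = 3`**: for `ϑ ∈ (0,2π)`, `s_m = sin((ϑ+2πm)∕6)`, `G` positive and
non-increasing on `(0,∞)` (`G ∈ iterMono 1`) and `x ≥ 0`,
`(sin(ϑ∕2)∕3) · Σ_{m<3} G(x+s_m²)∕s_m² ≤ Σ_{m<3} (−1)^m G(x+s_m²)∕s_m` — the domination constant `w = sin(ϑ∕2)∕L` WITHOUT dag-n07-w7's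
factor `1∕π` (`sineAlias_domination`), i.e. per coordinate the centre form dominates the matched form with constant ONE.  Proof: the only
negative term (`m = 1`) sits at the LARGEST `s`, so with `e_m := (−1)^m∕s_m − w∕s_m²` (`e_0, e_2 ≥ 0` by `w ≤ s_0, s_2`) and `G_0, G_2 ≥ G_1`,
`Σ e_m G_m ≥ (Σ e_m)·G_1 = 0`, the last by the two alias identities `Σ(−1)^m w∕s_m = 1 = Σ w²∕s_m²`. [folklore] -/
theorem sineAlias_domination_sharp_three {L : ℕ} (hL3 : L = 3) {ϑ : ℝ} (h0 : 0 < ϑ) (h1 : ϑ < 2 * π)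
    {G : ℝ → ℝ} (hG : G ∈ iterMono 1) {x : ℝ} (hx : 0 ≤ x) :
    sin (ϑ / 2) / L * ∑ m ∈ range L, G (x + sin ((ϑ + 2 * π * m) / (2 * L)) ^ 2) / sin ((ϑ + 2 * π * m) / (2 * L)) ^ 2
      ≤ transfer L (fun m => sin ((ϑ + 2 * π * m) / (2 * L))) G x := by
  subst hL3
  have hsin : 0 < sin (ϑ / 2) := sin_pos_of_pos_of_lt_pi (by linarith) (by linarith)
  -- the two alias identities at `L = 3`
  have hid1 := sum_neg_one_pow_mul_sin_half_div 1 (L := 3) (by norm_num) h0 h1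
  have hid2 := aliasing_identity (n := 3) (by norm_num) hsin.ne'
  -- expand the three-term sums
  simp only [transfer, Finset.sum_range_succ, Finset.sum_range_zero, zero_add, pow_zero, pow_one, neg_one_sq,
    Nat.cast_zero, Nat.cast_one, Nat.cast_ofNat, mul_zero, add_zero, mul_one, one_mul] at hid1 hid2 ⊢
  have hs0' : 0 < sin (ϑ / (2 * 3)) := by
    have := sineAlias_pos h0 h1 (show 0 < 3 by norm_num)
    simp only [Nat.cast_zero, Nat.cast_ofNat, mul_zero, add_zero] at this; exact this
  have hs1' : 0 < sin ((ϑ + 2 * π) / (2 * 3)) := by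
    have := sineAlias_pos h0 h1 (show 1 < 3 by norm_num)
    simp only [Nat.cast_one, Nat.cast_ofNat, mul_one] at this; exact this
  have hs2' : 0 < sin ((ϑ + 2 * π * 2) / (2 * 3)) := by
    have := sineAlias_pos h0 h1 (show 2 < 3 by norm_num)
    simp only [Nat.cast_ofNat] at this; exact this
  set s0 := sin (ϑ / (2 * 3)) with hs0
  set s1 := sin ((ϑ + 2 * π) / (2 * 3)) with hs1
  set s2 := sin ((ϑ + 2 * π * 2) / (2 * 3)) with hs2
  set S := sin (ϑ / 2) with hS
  -- shape facts: `S ≤ 3 s0, 3 s2` and `s0, s2 ≤ s1`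
  have hw_le0 : S ≤ 3 * s0 := sin_half_le_three_mul_sineAlias_zero h0 h1
  have hw_le2 : S ≤ 3 * s2 := sin_half_le_three_mul_sineAlias_two h0 h1
  have h01 : s0 ≤ s1 := (sineAlias_three_le_mid h0 h1).1
  have h21 : s2 ≤ s1 := (sineAlias_three_le_mid h0 h1).2
  have hG0 : G (x + s1 ^ 2) ≤ G (x + s0 ^ 2) :=
    iterMono_antitone hG (by positivity) (by nlinarith [pow_le_pow_left₀ hs0'.le h01 2])
  have hG2 : G (x + s1 ^ 2) ≤ G (x + s2 ^ 2) :=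
    iterMono_antitone hG (by positivity) (by nlinarith [pow_le_pow_left₀ hs2'.le h21 2])
  -- the coefficients `e_m = (−1)^m∕s_m − (S∕3)∕s_m²`
  have he0 : 0 ≤ 1 / s0 - S / 3 / s0 ^ 2 := by
    rw [sub_nonneg, div_le_div_iff₀ (by positivity) hs0']; nlinarith
  have he2 : 0 ≤ 1 / s2 - S / 3 / s2 ^ 2 := by
    rw [sub_nonneg, div_le_div_iff₀ (by positivity) hs2']; nlinarith
  -- `Σ e_m = 0` from the identities
  have hA : 1 / s0 - 1 / s1 + 1 / s2 = 3 / S := by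
    have h := hid1
    field_simp at h
    field_simp
    linear_combination h
  have hB : 1 / s0 ^ 2 + 1 / s1 ^ 2 + 1 / s2 ^ 2 = 9 / S ^ 2 := by
    have h := hid2
    field_simp at h
    field_simp
    linear_combination h
  have hsum : (1 / s0 - S / 3 / s0 ^ 2) + (-(1 / s1) - S / 3 / s1 ^ 2) + (1 / s2 - S / 3 / s2 ^ 2) = 0 := by
    have e : (1 / s0 - S / 3 / s0 ^ 2) + (-(1 / s1) - S / 3 / s1 ^ 2) + (1 / s2 - S / 3 / s2 ^ 2)
        = (1 / s0 - 1 / s1 + 1 / s2) - S / 3 * (1 / s0 ^ 2 + 1 / s1 ^ 2 + 1 / s2 ^ 2) := by ring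
    rw [e, hA, hB]
    field_simp
    ring
  -- conclude: `RHS − LHS = Σ e_m G_m ≥ (Σ e_m) G_1 = 0`
  have key : 0 ≤ (1 / s0 - S / 3 / s0 ^ 2) * G (x + s0 ^ 2) + (-(1 / s1) - S / 3 / s1 ^ 2) * G (x + s1 ^ 2)
      + (1 / s2 - S / 3 / s2 ^ 2) * G (x + s2 ^ 2) := by
    have h1' : (1 / s0 - S / 3 / s0 ^ 2) * G (x + s1 ^ 2) ≤ (1 / s0 - S / 3 / s0 ^ 2) * G (x + s0 ^ 2) :=
      mul_le_mul_of_nonneg_left hG0 he0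
    have h2' : (1 / s2 - S / 3 / s2 ^ 2) * G (x + s1 ^ 2) ≤ (1 / s2 - S / 3 / s2 ^ 2) * G (x + s2 ^ 2) :=
      mul_le_mul_of_nonneg_left hG2 he2
    have h0' : (1 / s0 - S / 3 / s0 ^ 2) * G (x + s1 ^ 2) + (-(1 / s1) - S / 3 / s1 ^ 2) * G (x + s1 ^ 2)
        + (1 / s2 - S / 3 / s2 ^ 2) * G (x + s1 ^ 2) = 0 := by
      rw [← add_mul, ← add_mul, hsum, zero_mul]
    linarith
  have hdiff : (1 / s0 * G (x + s0 ^ 2) + -1 / s1 * G (x + s1 ^ 2) + 1 / s2 * G (x + s2 ^ 2))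
      - S / 3 * (G (x + s0 ^ 2) / s0 ^ 2 + G (x + s1 ^ 2) / s1 ^ 2 + G (x + s2 ^ 2) / s2 ^ 2)
      = (1 / s0 - S / 3 / s0 ^ 2) * G (x + s0 ^ 2) + (-(1 / s1) - S / 3 / s1 ^ 2) * G (x + s1 ^ 2)
        + (1 / s2 - S / 3 / s2 ^ 2) * G (x + s2 ^ 2) := by ring
  linarith [key, hdiff]

/-- ★★★ **The sharp margin for `L = 3`, every finite set of coordinates** (dag-n07-w7's `aliasCore_margin` — «domination constants
multiply» — with the sharp one-coordinate constants `w_κ = sin(θ_κ∕2)∕3` of `sineAlias_domination_sharp_three`, `F = x⁻¹·x⁻¹`, `x = 0`):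
for `θ_κ ∈ (0,2π)` and `s_m(ϑ) = sin((ϑ+2πm)∕6)`,
`(Π_κ sin(θ_κ∕2)) · Σ_{m : J → Fin 3} (Π_κ s_{m_κ}(θ_κ)⁻²) ∕ (Σ_κ s_{m_κ}(θ_κ)²)² ≤ 3^{|J|} · Σ_m (Π_κ (−1)^{m_κ}∕s_{m_κ}(θ_κ)) ∕ (Σ_κ s²)²`
— dag-n07-w7's `aliasSum_margin` with `(πL)^{|J|}` replaced by `L^{|J|}`: the constant ONE. [folklore] -/
theorem aliasSum_margin_sharp_three {J : Type*} [Fintype J] [DecidableEq J] {L : ℕ} (hL3 : L = 3) (θ : J → ℝ)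
    (hθ : ∀ κ, 0 < θ κ ∧ θ κ < 2 * π) :
    (∏ κ, sin (θ κ / 2)) * ∑ m : J → Fin L,
        (∏ κ, (sin ((θ κ + 2 * π * (m κ : ℕ)) / (2 * L)) ^ 2)⁻¹) /
          (∑ κ, sin ((θ κ + 2 * π * (m κ : ℕ)) / (2 * L)) ^ 2) ^ 2
      ≤ (L : ℝ) ^ Fintype.card J * ∑ m : J → Fin L,
        (∏ κ, (-1 : ℝ) ^ (m κ : ℕ) / sin ((θ κ + 2 * π * (m κ : ℕ)) / (2 * L))) /
          (∑ κ, sin ((θ κ + 2 * π * (m κ : ℕ)) / (2 * L)) ^ 2) ^ 2 := by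
  classical
  have hL : Odd L := by subst hL3; exact ⟨1, rfl⟩
  have hLpos : (0 : ℝ) < L := by subst hL3; norm_num
  set s : J → ℕ → ℝ := fun κ m => sin ((θ κ + 2 * π * m) / (2 * L)) with hsdef
  have hs0 : ∀ κ m, m < L → 0 < s κ m := fun κ m hm => sineAlias_pos (hθ κ).1 (hθ κ).2 hm
  have hs : ∀ κ, ∃ p, ((∀ m m', m ≤ m' → m' ≤ p → m' < L → s κ m ≤ s κ m') ∧
      (∀ m m', p + 1 ≤ m → m ≤ m' → m' < L → s κ m' ≤ s κ m)) :=
    fun κ => sineAlias_hill (hθ κ).1 (hθ κ).2 L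
  set w : J → ℝ := fun κ => sin (θ κ / 2) / L with hwdef
  have hsinpos : ∀ κ, 0 < sin (θ κ / 2) := fun κ =>
    sin_pos_of_pos_of_lt_pi (by linarith [(hθ κ).1]) (by linarith [(hθ κ).2])
  have hw0 : ∀ κ, 0 ≤ w κ := fun κ => div_nonneg (hsinpos κ).le hLpos.le
  have hw : ∀ κ (G : ℝ → ℝ), G ∈ iterMono 1 → ∀ x : ℝ, 0 ≤ x →
      w κ * ∑ m ∈ range L, G (x + s κ m ^ 2) / s κ m ^ 2 ≤ transfer L (s κ) G x :=
    fun κ G hG x hx => sineAlias_domination_sharp_three hL3 (hθ κ).1 (hθ κ).2 hG hx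
  have hcore := aliasCore_margin hL s hs0 hs w hw0 hw (fun x => x⁻¹ * x⁻¹) iterMono_inv_mul_inv 0 le_rfl
  simp only [zero_add] at hcore
  have eB : ∑ m : J → Fin L, (∏ κ, (sin ((θ κ + 2 * π * (m κ : ℕ)) / (2 * L)) ^ 2)⁻¹) /
        (∑ κ, sin ((θ κ + 2 * π * (m κ : ℕ)) / (2 * L)) ^ 2) ^ 2
      = ∑ m : J → Fin L, (∏ κ, (s κ (m κ) ^ 2)⁻¹) *
          ((∑ κ, s κ (m κ) ^ 2)⁻¹ * (∑ κ, s κ (m κ) ^ 2)⁻¹) := by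
    refine Fintype.sum_congr _ _ (fun m => ?_)
    simp only [hsdef, div_eq_mul_inv, sq, mul_inv]
  have eA : ∑ m : J → Fin L, (∏ κ, (-1 : ℝ) ^ (m κ : ℕ) / sin ((θ κ + 2 * π * (m κ : ℕ)) / (2 * L))) /
        (∑ κ, sin ((θ κ + 2 * π * (m κ : ℕ)) / (2 * L)) ^ 2) ^ 2
      = ∑ m : J → Fin L, (∏ κ, (-1 : ℝ) ^ (m κ : ℕ) / s κ (m κ)) *
          ((∑ κ, s κ (m κ) ^ 2)⁻¹ * (∑ κ, s κ (m κ) ^ 2)⁻¹) := by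
    refine Fintype.sum_congr _ _ (fun m => ?_)
    simp only [hsdef, div_eq_mul_inv, sq, mul_inv]
  rw [eB, eA]
  have hwprod : (∏ κ, w κ) = (∏ κ, sin (θ κ / 2)) / (L : ℝ) ^ Fintype.card J := by
    rw [hwdef, Finset.prod_div_distrib, Finset.prod_const, Finset.card_univ]
  rw [hwprod, div_mul_eq_mul_div, div_le_iff₀ (by positivity)] at hcore
  linarith [hcore]

end Three


end Summit.QuantumFields.YangMills.Theorems.N07AliasSumMarginSharp

end
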